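import Summits.ABC.ABC.Theses.IsogenyGlueCongruence
import Summits.ABC.ABC.Theorems.IsogenyGlueCongruenceSharpDegreeOfPolyDegreeValuation
import Summits.ABC.ABC.Theorems.IsogenyGlueCongruenceSharpDegreeOfPolyHeightPosition
import Summits.ABC.ABC.Theorems.SharpDegreeOfPolyHeight.Negative.HypothesisFloor

set_option linter.dupNamespace false

/-!
# Crux `SharpDegreeOfPolyHeight` (stmt-ABC-16009) — crux-ideate round 1, ideator 2: census sketch

`R' := SharpDegreeOfPolyHeight = (H → X)`, `H` = polynomial height (Szpiro) conjecture for
semistable curves, `X = SemistableDegreeConjecture`.  This file is NOT a line and files NO idea card: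
it is the kernel-checked part of the ideator's strategy census (`BarrierNotes-r1-k2.md`), recording

* the modular-form-free residual `PureResidual := PolyHeightSS → SharpHeightSS` ("Szpiro's original
  conjecture with undetermined exponent ⟹ the `6 + ε` form", semistable, `max(|Δ|,|c₄|³)` gauge) and
  the trivial direction `sharpHeightSS_le` bookkeeping it needs;
* the ONE genuine use of `H` found by either crux chain (sibling crux R = stmt-ABC-10895, card
  `totient-level-ledger`, triage r1 ×3 pass): `H` ⟹ polynomial Szpiro ⟹ `v_p(Δ_min) log p ≤ A log N + A`
  ⟹ EXPONENT COLLAPSE at large primes, `v_p(Δ_min) ≤ B(θ)` for `p ≥ N^θ` — proved here directly from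
  `H` (in height form no Zagier / Petersson / Manin input is needed, the one place `R'` is cleaner
  than `R`);
* the typed graded level statement `LevelSzpiro m` (`T_m`) that the collapse reduces regime F to.

Everything else about `R'` is already landed: `…SharpDegreeOfPolyHeightPosition` (p117414:
`R' ↔ (H → ABC)` modulo four named inputs, `¬R' ↔ H ∧ ¬X`, `ABC → H`) and
`SharpDegreeOfPolyHeight.Negative.HypothesisFloor` (p117587: any witness of `H` has `σ > 6`).
-/

noncomputable section

namespace Summit.ABC.ABC.Cruxes.SharpDegreeOfPolyHeight.Ideator2

open Summit.ABC.ABC.Theses.IsogenyGlueCongruence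
open Literature.NumberTheory.EllipticCurves Literature.NumberTheory.EllipticCurves.ModularForms
open Literature.NumberTheory.DiophantineGeometry
open WeierstrassCurve

/-- `H`: the antecedent of the crux, verbatim (polynomial height conjecture, semistable curves). -/
def PolyHeightSS : Prop :=
  ∃ σ C : ℝ, ∀ (W : WeierstrassCurve ℚ) [W.IsElliptic] [W.IsGloballyMinimal]
    [NeZero (W.conductorNorm ℤ)], W.IsSemistable ℤ →
      ((max |W.Δ| (|W.c₄| ^ 3) : ℚ) : ℝ) ≤ C * (W.conductorNorm ℤ : ℝ) ^ σ

/-- The sharp height conjecture for semistable curves in the same gauge (`6 + ε`): the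
modular-form-free consequent.  Modulo `ModularDatumExists` + a semistable Manin bound + the PROVED
Petersson upper bound / covolume inequality / Zagier identity it implies `X`; modulo
`PeterssonLowerBound` `X` implies it (both directions are the dictionary of p117414 / p99967). -/
def SharpHeightSS : Prop :=
  ∀ ε : ℝ, 0 < ε → ∃ C : ℝ, ∀ (W : WeierstrassCurve ℚ) [W.IsElliptic] [W.IsGloballyMinimal]
    [NeZero (W.conductorNorm ℤ)], W.IsSemistable ℤ →
      ((max |W.Δ| (|W.c₄| ^ 3) : ℚ) : ℝ) ≤ C * (W.conductorNorm ℤ : ℝ) ^ (6 + ε)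

/-- The pure residual of the crux: "undetermined-exponent Szpiro ⟹ (6+ε)-Szpiro" on semistable
curves over `ℚ`.  abc-strength (≡ `R'` ≡ `R` ≡ (poly-abc → abc) modulo named facts). -/
def PureResidual : Prop := PolyHeightSS → SharpHeightSS

/-- The crux's antecedent IS `PolyHeightSS` (definitional bookkeeping for the census). -/
theorem crux_eq : SharpDegreeOfPolyHeight = (PolyHeightSS → SemistableDegreeConjecture) := rfl

/-- The graded level-`m` Szpiro statement `T_m` of the sibling card `totient-level-ledger`
(stmt-ABC-10895, ideator 2), transposed: `Σ_{p ∣ N} gcd(m, v_p(Δ_min)) · log p ≤ (6+ε) log N + C`.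
`T_m` reads only the finite Galois module `E[m]` (`gcd(m, v_p) = #Φ_p[m]`); `T_6` is trivial
(`N = rad Δ_min`), sharp Szpiro ⟹ every `T_m`, and for prime `ℓ ≥ 7` `T_ℓ` is the conductor /
Serre-level inequality `N ≤ C · N(ρ̄_{E,ℓ})^{(ℓ−1)/(ℓ−6)+ε}` (conductor-effective Mordell for the
twists `X_{ρ̄}(ℓ)`; open). -/
def LevelSzpiro (m : ℕ) : Prop :=
  ∀ ε : ℝ, 0 < ε → ∃ C : ℝ, ∀ (W : WeierstrassCurve ℚ) [W.IsElliptic], W.IsSemistable ℤ →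
    (∑ p ∈ (W.conductorNorm ℤ).primeFactors,
        ((Nat.gcd m ((W.minimalDiscriminantNorm ℤ).factorization p) : ℕ) : ℝ) * Real.log p) ≤
      (6 + ε) * Real.log (W.conductorNorm ℤ) + C

/-! ## The one genuine consequence of `H`: exponent collapse at large primes -/

/-- **`H` ⟹ polynomial Szpiro** for every semistable `E/ℚ` (through a global minimal model).
[folklore] -/
theorem polySzpiro_of_polyHeight (hH : PolyHeightSS) :
    ∃ m A' : ℝ, 0 ≤ m ∧ ∀ (W : WeierstrassCurve ℚ) [W.IsElliptic], W.IsSemistable ℤ →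
      (W.minimalDiscriminantNorm ℤ : ℝ) ≤ A' * (W.conductorNorm ℤ : ℝ) ^ m := by
  obtain ⟨K, C, h⟩ := hH
  refine ⟨max K 0, max C 0, le_max_right _ _, fun W _ hss => ?_⟩
  obtain ⟨W₁, hE₁, hM₁, hss₁, hN₁, hΔ₁⟩ :=
    Summit.ABC.ABC.Theorems.SharpDegreeOfPolyDegree.Negative.exists_globallyMinimal_model W
  haveI := hE₁
  haveI := hM₁
  have hNpos : 0 < W₁.conductorNorm ℤ := conductorNorm_pos_holds W₁
  haveI : NeZero (W₁.conductorNorm ℤ) := ⟨hNpos.ne'⟩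
  have h1 := h W₁ (hss₁ hss)
  have hN1 : (1 : ℝ) ≤ (W₁.conductorNorm ℤ : ℝ) := by exact_mod_cast hNpos
  have hN0 : (0 : ℝ) ≤ (W₁.conductorNorm ℤ : ℝ) := by linarith
  calc (W.minimalDiscriminantNorm ℤ : ℝ) = ((|W₁.Δ| : ℚ) : ℝ) := hΔ₁.symm
    _ ≤ ((max |W₁.Δ| (|W₁.c₄| ^ 3) : ℚ) : ℝ) := Rat.cast_le.mpr (le_max_left _ _)
    _ ≤ C * (W₁.conductorNorm ℤ : ℝ) ^ K := h1
    _ ≤ max C 0 * (W₁.conductorNorm ℤ : ℝ) ^ K :=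
        mul_le_mul_of_nonneg_right (le_max_left _ _) (Real.rpow_nonneg hN0 _)
    _ ≤ max C 0 * (W₁.conductorNorm ℤ : ℝ) ^ (max K 0) :=
        mul_le_mul_of_nonneg_left (Real.rpow_le_rpow_of_exponent_le hN1 (le_max_left _ _))
          (le_max_right _ _)
    _ = max C 0 * (W.conductorNorm ℤ : ℝ) ^ (max K 0) := by rw [hN₁]

/-- **Single-valuation bound under polynomial Szpiro**: `v_p(Δ_min) · log p ≤ A log N + A` with
`A ≥ 0`. [folklore] -/
theorem valuationLogBound_of_polySzpiro
    (hSz : ∃ m A' : ℝ, 0 ≤ m ∧ ∀ (W : WeierstrassCurve ℚ) [W.IsElliptic], W.IsSemistable ℤ →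
      (W.minimalDiscriminantNorm ℤ : ℝ) ≤ A' * (W.conductorNorm ℤ : ℝ) ^ m) :
    ∃ A : ℝ, 0 ≤ A ∧ ∀ (W : WeierstrassCurve ℚ) [W.IsElliptic], W.IsSemistable ℤ → ∀ p : ℕ, p.Prime →
      (((W.minimalDiscriminantNorm ℤ).factorization p : ℕ) : ℝ) * Real.log p ≤
        A * Real.log (W.conductorNorm ℤ) + A := by
  obtain ⟨m, A', hm, h⟩ := hSz
  refine ⟨max (Real.log (max A' 1)) m, le_trans hm (le_max_right _ _), fun W _ hss p hp => ?_⟩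
  have hΔpos : 0 < W.minimalDiscriminantNorm ℤ := minimalDiscriminantNorm_pos_holds W
  have hNpos : 0 < W.conductorNorm ℤ := conductorNorm_pos_holds W
  have hN1 : (1 : ℝ) ≤ (W.conductorNorm ℤ : ℝ) := by exact_mod_cast hNpos
  have hlogN : 0 ≤ Real.log (W.conductorNorm ℤ : ℝ) := Real.log_nonneg hN1
  have h1 := Summit.ABC.ABC.Theorems.SharpDegreeOfPolyDegree.factorization_mul_log_le hΔpos.ne' hp
    (n := W.minimalDiscriminantNorm ℤ)
  have hA1 : 1 ≤ max A' 1 := le_max_right _ _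
  have h2 : (W.minimalDiscriminantNorm ℤ : ℝ) ≤ max A' 1 * (W.conductorNorm ℤ : ℝ) ^ m :=
    (h W hss).trans (mul_le_mul_of_nonneg_right (le_max_left _ _) (Real.rpow_nonneg (by linarith) _))
  have hΔr : (0 : ℝ) < (W.minimalDiscriminantNorm ℤ : ℝ) := by exact_mod_cast hΔpos
  have h3 : Real.log (W.minimalDiscriminantNorm ℤ : ℝ) ≤
      Real.log (max A' 1) + m * Real.log (W.conductorNorm ℤ : ℝ) := by
    calc Real.log (W.minimalDiscriminantNorm ℤ : ℝ)
          ≤ Real.log (max A' 1 * (W.conductorNorm ℤ : ℝ) ^ m) := Real.log_le_log hΔr h2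
      _ = Real.log (max A' 1) + m * Real.log (W.conductorNorm ℤ : ℝ) := by
          rw [Real.log_mul (ne_of_gt (lt_of_lt_of_le one_pos hA1))
            (ne_of_gt (Real.rpow_pos_of_pos (by linarith) _)), Real.log_rpow (by linarith)]
  calc (((W.minimalDiscriminantNorm ℤ).factorization p : ℕ) : ℝ) * Real.log p
        ≤ Real.log (max A' 1) + m * Real.log (W.conductorNorm ℤ : ℝ) := h1.trans h3
    _ ≤ max (Real.log (max A' 1)) m +
          max (Real.log (max A' 1)) m * Real.log (W.conductorNorm ℤ : ℝ) :=
        add_le_add (le_max_left _ _) (mul_le_mul_of_nonneg_right (le_max_right _ _) hlogN)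
    _ = max (Real.log (max A' 1)) m * Real.log (W.conductorNorm ℤ) +
          max (Real.log (max A' 1)) m := by
        ring

/-- **`H` ⟹ single-valuation bound** (height-form `L0`). [folklore] -/
theorem valuationLogBound_of_polyHeight (hH : PolyHeightSS) :
    ∃ A : ℝ, 0 ≤ A ∧ ∀ (W : WeierstrassCurve ℚ) [W.IsElliptic], W.IsSemistable ℤ → ∀ p : ℕ, p.Prime →
      (((W.minimalDiscriminantNorm ℤ).factorization p : ℕ) : ℝ) * Real.log p ≤
        A * Real.log (W.conductorNorm ℤ) + A :=
  valuationLogBound_of_polySzpiro (polySzpiro_of_polyHeight hH)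

/-- **EXPONENT COLLAPSE at large primes under `H`**: for every `θ > 0` there is `B = B(θ, H)` such
that every semistable elliptic `E/ℚ` has `v_p(Δ_min(E)) ≤ B` at every prime `p ∣ N_E` with
`p ≥ N_E^θ`.  This is the only consequence of `H` either crux chain found to act WITHOUT exponent loss:
on the primes `≥ N^θ` Szpiro's weighted sum `Σ v_p log p` becomes a sum with BOUNDED coefficients,
i.e. the fixed-level graded statement `LevelSzpiro B!` (`gcd(B!, v) = v` for `v ≤ B`), a statement
about the single finite Galois module `E[B!]`.  The discriminant mass on primes `< N^θ` (regime S,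
where Masser's witnesses live) is untouched. [folklore] -/
theorem largePrimeExponentBound_of_polyHeight (hH : PolyHeightSS) {θ : ℝ} (hθ : 0 < θ) :
    ∃ B : ℝ, ∀ (W : WeierstrassCurve ℚ) [W.IsElliptic], W.IsSemistable ℤ → ∀ p : ℕ, p.Prime →
      p ∣ W.conductorNorm ℤ → (W.conductorNorm ℤ : ℝ) ^ θ ≤ p →
        (((W.minimalDiscriminantNorm ℤ).factorization p : ℕ) : ℝ) ≤ B := by
  obtain ⟨A, hA0, hA⟩ := valuationLogBound_of_polyHeight hH
  have hlog2 : 0 < Real.log 2 := Real.log_pos (by norm_num)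
  refine ⟨A / θ + A / (θ * Real.log 2), fun W _ hss p hp hpN hNθ => ?_⟩
  have hNpos : 0 < W.conductorNorm ℤ := conductorNorm_pos_holds W
  -- `p ∣ N` and `p ≥ 2` give `N ≥ 2`, so `log N ≥ log 2 > 0`.
  have hN2 : (2 : ℝ) ≤ (W.conductorNorm ℤ : ℝ) := by
    have : p ≤ W.conductorNorm ℤ := Nat.le_of_dvd hNpos hpN
    exact_mod_cast hp.two_le.trans this
  have hlogN : Real.log 2 ≤ Real.log (W.conductorNorm ℤ : ℝ) := Real.log_le_log (by norm_num) hN2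
  have hlogN0 : 0 < Real.log (W.conductorNorm ℤ : ℝ) := lt_of_lt_of_le hlog2 hlogN
  have hp0 : (0 : ℝ) < p := by exact_mod_cast hp.pos
  -- `θ log N ≤ log p`
  have hθlog : θ * Real.log (W.conductorNorm ℤ : ℝ) ≤ Real.log p := by
    have := Real.log_le_log (Real.rpow_pos_of_pos (by linarith) θ) hNθ
    rwa [Real.log_rpow (by linarith)] at this
  have hθlog0 : 0 < θ * Real.log (W.conductorNorm ℤ : ℝ) := mul_pos hθ hlogN0
  set v : ℝ := (((W.minimalDiscriminantNorm ℤ).factorization p : ℕ) : ℝ) with hv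
  have hv0 : 0 ≤ v := by rw [hv]; exact_mod_cast Nat.zero_le _
  have h1 : v * Real.log p ≤ A * Real.log (W.conductorNorm ℤ) + A := hA W hss p hp
  -- hence `v · θ log N ≤ A log N + A`
  have h2 : v * (θ * Real.log (W.conductorNorm ℤ : ℝ)) ≤ A * Real.log (W.conductorNorm ℤ) + A :=
    (mul_le_mul_of_nonneg_left hθlog hv0).trans h1
  have h3 : v ≤ (A * Real.log (W.conductorNorm ℤ) + A) / (θ * Real.log (W.conductorNorm ℤ : ℝ)) := by
    rw [le_div_iff₀ hθlog0]; exact h2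
  have h4 : (A * Real.log (W.conductorNorm ℤ) + A) / (θ * Real.log (W.conductorNorm ℤ : ℝ)) =
      A / θ + A / (θ * Real.log (W.conductorNorm ℤ : ℝ)) := by
    field_simp
  have h5 : A / (θ * Real.log (W.conductorNorm ℤ : ℝ)) ≤ A / (θ * Real.log 2) := by
    apply div_le_div_of_nonneg_left hA0 (mul_pos hθ hlog2)
    exact mul_le_mul_of_nonneg_left hlogN hθ.le
  calc v ≤ A / θ + A / (θ * Real.log (W.conductorNorm ℤ : ℝ)) := h3.trans_eq h4
    _ ≤ A / θ + A / (θ * Real.log 2) := by linarith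

/-! ## Pointers (no new content): the landed position of `R'` -/

/-- `R'` closes the day `X` lands (landed one-liner, restated for the census). -/
theorem of_target (hX : SemistableDegreeConjecture) : SharpDegreeOfPolyHeight := fun _ => hX

/-- `¬R' ↔ H ∧ ¬X` (landed, p117414): a disproof must PROVE undetermined-exponent Szpiro. -/
example : ¬ SharpDegreeOfPolyHeight ↔
    ((∃ σ C : ℝ, ∀ (W : WeierstrassCurve ℚ) [W.IsElliptic] [W.IsGloballyMinimal]
        [NeZero (W.conductorNorm ℤ)], W.IsSemistable ℤ →
        ((max |W.Δ| (|W.c₄| ^ 3) : ℚ) : ℝ) ≤ C * (W.conductorNorm ℤ : ℝ) ^ σ) ∧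
      ¬ SemistableDegreeConjecture) :=
  Summit.ABC.ABC.Theorems.SharpDegreeOfPolyHeight.not_iff

end Summit.ABC.ABC.Cruxes.SharpDegreeOfPolyHeight.Ideator2

end
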